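import Summits.Parity.GeneralizedHardyLittlewood.Theorems.LiouvilleShiftedTablesTypeI2DilatedAssemble2

/-!
# THE ASSEMBLY of the line `peel-to-drappeau` for the crux `TypeI2Dilated` (stmt-Parity-14272)

Part 3/6: the Bombieri–Vinogradov range `bvRange_bound` from `BVLiouville` alone (one class and height per modulus by a choice of maximisers, multiplicity `τ(d)³` by Cauchy–Schwarz).

Route `LiouvilleShiftedTables` (Parity / GeneralizedHardyLittlewood); registered skeleton
`Cruxes/TypeI2Dilated/Lines/peel-to-drappeau.lean` (v6), stub `stub_assembleFrom : AssembleFrom` where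
`AssembleFrom := URBound → (DilatedTypeII → DilatedMainTerms → DilatedDivisorAP → BVLiouville → TypeI2Dilated)`
(vocabulary in `Summits.Parity.GeneralizedHardyLittlewood.Theorems.LiouvilleShiftedTablesDefs`).  The paper proof with constants and the audit of the four inputs is the
second module docstring of part 5. [this line: Lines/peel-to-drappeau.md]
-/

noncomputable section

namespace Summit.Parity.GeneralizedHardyLittlewood.Cruxes.TypeI2Dilated.PeelToDrappeau

open Finset Real
open scoped ArithmeticFunction.sigma Classical
open Literature.NumberTheory.Sieve Literature.NumberTheory.Sieve.Drappeau2017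
  Literature.NumberTheory.Sieve.FouvryTenenbaum2021 Literature.NumberTheory.Sieve.DispersionAssembly
open Summit.Parity.GeneralizedHardyLittlewood.Theses.LiouvilleShiftedTables (TypeI2Dilated BVLiouville)

set_option maxHeartbeats 1600000 in
-- (one 320-line proof: choice of maximisers + Cauchy–Schwarz + `BVLiouville`; the default budget times out)
/-- L4 — the BV range (Step 2): from `BVLiouville`, for `Q R S' ≤ x^{1/2-ε}`,
`∑_{q ≤ Q} ∑_{r ≤ R} ∑_{s ≤ S'} |I(q,r,s)| ≤ C x/(log x)^A`. [this line] -/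
theorem bvRange_bound (hBV : BVLiouville) (c : ℤ) {ε : ℝ} (hε : 0 < ε) (hε' : ε ≤ 1 / 4) {A : ℝ}
    (hA : 0 < A) :
    ∃ C x₀ : ℝ, ∀ x : ℝ, x₀ ≤ x → ∀ w Q : ℕ, ∀ R S' y : ℝ, 0 ≤ y → y ≤ x →
      (Q : ℝ) * R * S' ≤ x ^ (1 / 2 - ε) →
      ∑ q ∈ Icc 1 Q, ∑ r ∈ Icc 1 ⌊R⌋₊, ∑ s ∈ Icc 1 ⌊S'⌋₊, |innerSum c q w r s y| ≤
        C * x / Real.log x ^ A := by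
  obtain ⟨C₆, hC₆, h6⟩ := exists_sum_sigma_zero_pow_div_le_real 6
  norm_num at h6
  obtain ⟨Cb, xb, hb⟩ := hBV (ε / 2) (by positivity) (2 * A + 128) (by positivity)
  obtain ⟨X₁, hX₁⟩ := Negative.exists_log_rpow_le A (s := 1 / 2) (K := 1) (by norm_num) one_pos
  set K₀ : ℝ := Real.sqrt (2 ^ 130 * C₆ * |Cb|) with hK₀
  have hK₀0 : 0 ≤ K₀ := Real.sqrt_nonneg _
  refine ⟨(c.natAbs : ℝ) + 2 + K₀, max (max xb X₁) (max 3 (c.natAbs : ℝ)), ?_⟩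
  intro x hx w Q R S' y hy0 hyx hQRS
  -- unpack `x ≥ x₀`
  have hxb : xb ≤ x := ((le_max_left _ _).trans (le_max_left _ _)).trans hx
  have hX₁x : X₁ ≤ x := ((le_max_right _ _).trans (le_max_left _ _)).trans hx
  have hx3 : 3 ≤ x := ((le_max_left _ _).trans (le_max_right _ _)).trans hx
  have hxc : (c.natAbs : ℝ) ≤ x := ((le_max_right _ _).trans (le_max_right _ _)).trans hx
  have hx1 : 1 ≤ x := by linarith
  have hx0 : 0 < x := by linarith
  have hL1 : 1 ≤ Real.log x := log_one_le_of_three_le hx3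
  have hL0 : 0 < Real.log x := by linarith
  have hCpos : 0 ≤ ((c.natAbs : ℝ) + 2 + K₀) * x / Real.log x ^ A := by positivity
  -- WLOG `R, S' ≥ 0`
  rcases lt_or_ge R 0 with hRneg | hR0
  · rw [Nat.floor_of_nonpos hRneg.le]
    simpa using hCpos
  rcases lt_or_ge S' 0 with hSneg | hS0
  · rw [Nat.floor_of_nonpos hSneg.le]
    simpa using hCpos
  -- notation
  set Y : ℝ := y + c with hYdef
  have hYfl : (⌊Y⌋₊ : ℝ) ≤ 2 * x := by
    rcases le_or_gt 0 Y with hY | hY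
    · refine (Nat.floor_le hY).trans ?_
      have h' : (c : ℝ) ≤ ((c.natAbs : ℤ) : ℝ) := Int.cast_le.mpr Int.le_natAbs
      rw [Int.cast_natCast] at h'
      rw [hYdef]; linarith
    · rw [Nat.floor_of_nonpos hY.le, Nat.cast_zero]; positivity
  set Box := Icc 1 Q ×ˢ (Icc 1 ⌊R⌋₊ ×ˢ Icc 1 ⌊S'⌋₊) with hBox
  set B : ℕ × ℕ × ℕ → ℝ := fun t =>
    |∑ n ∈ Icc 1 (bvU c t.1 w (t.2.1 * t.2.2) Y),
      (ArithmeticFunction.liouville (Nat.lcm (t.2.1 * t.2.2) t.1 * n + bvCls c t.1 w (t.2.1 * t.2.2) Y) : ℝ)|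
    with hB
  have hB0 : ∀ t, 0 ≤ B t := fun t => abs_nonneg _
  set D : ℕ := ⌊(2 * x) ^ (1 / 2 - ε / 2)⌋₊ with hD
  set fib : ℕ → Finset (ℕ × ℕ × ℕ) := fun d =>
    Box.filter (fun t : ℕ × ℕ × ℕ => Nat.lcm (t.2.1 * t.2.2) t.1 = d) with hfib
  -- facts about box elements
  have hBoxmem : ∀ t ∈ Box, 1 ≤ t.1 ∧ 1 ≤ t.2.1 ∧ 1 ≤ t.2.2 ∧
      1 ≤ Nat.lcm (t.2.1 * t.2.2) t.1 ∧ Nat.lcm (t.2.1 * t.2.2) t.1 ≤ D := by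
    intro t ht
    simp only [hBox, Finset.mem_product, Finset.mem_Icc] at ht
    obtain ⟨⟨hq1, hqQ⟩, ⟨hr1, hrR⟩, ⟨hs1, hsS⟩⟩ := ht
    have hrs : 0 < t.2.1 * t.2.2 := Nat.mul_pos hr1 hs1
    have hl1 : 1 ≤ Nat.lcm (t.2.1 * t.2.2) t.1 := Nat.lcm_pos hrs hq1
    refine ⟨hq1, hr1, hs1, hl1, ?_⟩
    have hle : Nat.lcm (t.2.1 * t.2.2) t.1 ≤ t.2.1 * t.2.2 * t.1 :=
      Nat.le_of_dvd (Nat.mul_pos hrs hq1) (Nat.lcm_dvd_mul _ _)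
    rw [hD, Nat.le_floor_iff (by positivity)]
    have hR1 : (t.2.1 : ℝ) ≤ R := le_trans (by exact_mod_cast hrR) (Nat.floor_le hR0)
    have hS1 : (t.2.2 : ℝ) ≤ S' := le_trans (by exact_mod_cast hsS) (Nat.floor_le hS0)
    have hQ1 : (t.1 : ℝ) ≤ Q := by exact_mod_cast hqQ
    calc (Nat.lcm (t.2.1 * t.2.2) t.1 : ℝ) ≤ ((t.2.1 * t.2.2 * t.1 : ℕ) : ℝ) := by exact_mod_cast hle
      _ = (t.1 : ℝ) * t.2.1 * t.2.2 := by push_cast; ring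
      _ ≤ (Q : ℝ) * R * S' := by
          refine mul_le_mul (mul_le_mul hQ1 hR1 (by positivity) (by positivity)) hS1 (by positivity)
            (by positivity)
      _ ≤ x ^ (1 / 2 - ε) := hQRS
      _ ≤ x ^ (1 / 2 - ε / 2) := Real.rpow_le_rpow_of_exponent_le hx1 (by linarith)
      _ ≤ (2 * x) ^ (1 / 2 - ε / 2) := Real.rpow_le_rpow hx0.le (by linarith) (by linarith)
  -- per triple: `|I| ≤ B t + (|c| + 2)`
  have hper : ∀ q ∈ Icc 1 Q, ∀ r ∈ Icc 1 ⌊R⌋₊, ∀ s ∈ Icc 1 ⌊S'⌋₊,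
      |innerSum c q w r s y| ≤ B (q, r, s) + ((c.natAbs : ℝ) + 2) := by
    intro q hq r hr s hs
    have hq1 := (Finset.mem_Icc.1 hq).1
    have hr1 := (Finset.mem_Icc.1 hr).1
    have hs1 := (Finset.mem_Icc.1 hs).1
    have h1 := abs_innerSum_sub_classSum_le c q w hr1 hs1 y
    rw [← hYdef] at h1
    have h2 := abs_classSum_le_bv c hq1 w (Nat.mul_pos hr1 hs1) Y
    have h3 := abs_sub_abs_le_abs_sub (innerSum c q w r s y) (classSum c q w (r * s) Y)
    have hBt : B (q, r, s) = |∑ n ∈ Icc 1 (bvU c q w (r * s) Y),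
        (ArithmeticFunction.liouville (Nat.lcm (r * s) q * n + bvCls c q w (r * s) Y) : ℝ)| := rfl
    rw [hBt]
    linarith
  -- sum over the box
  have hsumI : ∑ q ∈ Icc 1 Q, ∑ r ∈ Icc 1 ⌊R⌋₊, ∑ s ∈ Icc 1 ⌊S'⌋₊, |innerSum c q w r s y| ≤
      ∑ t ∈ Box, B t + ((c.natAbs : ℝ) + 2) * ((Q : ℝ) * ⌊R⌋₊ * ⌊S'⌋₊) := by
    calc ∑ q ∈ Icc 1 Q, ∑ r ∈ Icc 1 ⌊R⌋₊, ∑ s ∈ Icc 1 ⌊S'⌋₊, |innerSum c q w r s y|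
        ≤ ∑ q ∈ Icc 1 Q, ∑ r ∈ Icc 1 ⌊R⌋₊, ∑ s ∈ Icc 1 ⌊S'⌋₊, (B (q, r, s) + ((c.natAbs : ℝ) + 2)) :=
          Finset.sum_le_sum fun q hq => Finset.sum_le_sum fun r hr => Finset.sum_le_sum fun s hs =>
            hper q hq r hr s hs
      _ = ∑ t ∈ Box, (B t + ((c.natAbs : ℝ) + 2)) := by
          rw [hBox, Finset.sum_product]
          refine Finset.sum_congr rfl fun q _ => ?_
          rw [Finset.sum_product]
      _ = ∑ t ∈ Box, B t + ((c.natAbs : ℝ) + 2) * ((Q : ℝ) * ⌊R⌋₊ * ⌊S'⌋₊) := by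
          rw [Finset.sum_add_distrib, Finset.sum_const, nsmul_eq_mul, hBox, Finset.card_product,
            Finset.card_product]
          simp only [Nat.card_Icc, add_tsub_cancel_right]
          push_cast; ring
  -- maximisers on each fibre
  have hmax : ∀ d : ℕ, ∃ t : ℕ × ℕ × ℕ, ((fib d).Nonempty → t ∈ fib d ∧ ∀ t' ∈ fib d, B t' ≤ B t) := by
    intro d
    by_cases h : (fib d).Nonempty
    · obtain ⟨t, ht, hm⟩ := Finset.exists_max_image (fib d) B h
      exact ⟨t, fun _ => ⟨ht, hm⟩⟩
    · exact ⟨(0, 0, 0), fun h' => absurd h' h⟩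
  choose tstar htstar using hmax
  set M : ℕ → ℝ := fun d => if (fib d).Nonempty then B (tstar d) else 0 with hM
  have hM0 : ∀ d, 0 ≤ M d := by
    intro d; simp only [hM]; split_ifs <;> [exact hB0 _; exact le_rfl]
  have hBM : ∀ d, ∀ t ∈ fib d, B t ≤ M d := by
    intro d t ht
    have hne : (fib d).Nonempty := ⟨t, ht⟩
    simp only [hM, if_pos hne]
    exact (htstar d hne).2 t ht
  -- facts about the maximiser of a nonempty fibre
  have hstar : ∀ d, (fib d).Nonempty → tstar d ∈ Box ∧ Nat.lcm ((tstar d).2.1 * (tstar d).2.2) (tstar d).1 = d := by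
    intro d hne
    have := (htstar d hne).1
    rw [hfib, Finset.mem_filter] at this
    exact this
  have hUle : ∀ d, (fib d).Nonempty → d * bvU c (tstar d).1 w ((tstar d).2.1 * (tstar d).2.2) Y ≤ ⌊Y⌋₊ := by
    intro d hne
    obtain ⟨-, hl⟩ := hstar d hne
    rw [bvU, hl]
    exact (Nat.mul_div_le _ _).trans (Nat.sub_le _ _)
  have hMtriv : ∀ d ∈ Icc 1 D, M d ≤ 2 * x / d := by
    intro d hd
    have hd1 : 1 ≤ d := (Finset.mem_Icc.1 hd).1
    have hd0 : (0 : ℝ) < d := by exact_mod_cast hd1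
    simp only [hM]
    split_ifs with hne
    · obtain ⟨-, hl⟩ := hstar d hne
      have hU := hUle d hne
      simp only [hB]
      rw [hl]
      set U := bvU c (tstar d).1 w ((tstar d).2.1 * (tstar d).2.2) Y with hU'
      calc |∑ n ∈ Icc 1 U, (ArithmeticFunction.liouville (d * n + bvCls c (tstar d).1 w
              ((tstar d).2.1 * (tstar d).2.2) Y) : ℝ)|
          ≤ ∑ n ∈ Icc 1 U, |(ArithmeticFunction.liouville (d * n + bvCls c (tstar d).1 w
              ((tstar d).2.1 * (tstar d).2.2) Y) : ℝ)| := Finset.abs_sum_le_sum_abs _ _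
        _ ≤ ∑ _n ∈ Icc 1 U, (1 : ℝ) := by
            refine Finset.sum_le_sum fun n hn => ?_
            rw [Negative.abs_liouville_eq_one]
            have := (Finset.mem_Icc.1 hn).1
            positivity
        _ = U := by simp
        _ ≤ 2 * x / d := by
            rw [le_div_iff₀ hd0]
            have : ((d * U : ℕ) : ℝ) ≤ ⌊Y⌋₊ := by exact_mod_cast hU
            push_cast at this
            linarith
    · positivity
  -- the BV choice functions
  set cfun : ℕ → ℤ := fun d =>
    if (fib d).Nonempty then (bvCls c (tstar d).1 w ((tstar d).2.1 * (tstar d).2.2) Y : ℤ) else 0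
    with hcfun
  set yfun : ℕ → ℝ := fun d =>
    if (fib d).Nonempty then (d : ℝ) * (bvU c (tstar d).1 w ((tstar d).2.1 * (tstar d).2.2) Y : ℕ) else 0
    with hyfun
  have hcfun' : ∀ d : ℕ, 1 ≤ d → 0 ≤ cfun d ∧ cfun d < d := by
    intro d hd1
    simp only [hcfun]
    split_ifs with hne
    · obtain ⟨hbox, hl⟩ := hstar d hne
      obtain ⟨hq1, hr1, hs1, -, -⟩ := hBoxmem _ hbox
      refine ⟨by positivity, ?_⟩
      have := bvCls_lt c hq1 w (Nat.mul_pos hr1 hs1) Y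
      rw [hl] at this
      exact_mod_cast this
    · exact ⟨le_rfl, by exact_mod_cast hd1⟩
  have hyfun' : ∀ d : ℕ, 0 ≤ yfun d ∧ yfun d ≤ 2 * x := by
    intro d
    simp only [hyfun]
    split_ifs with hne
    · refine ⟨by positivity, ?_⟩
      have hU := hUle d hne
      have : ((d * bvU c (tstar d).1 w ((tstar d).2.1 * (tstar d).2.2) Y : ℕ) : ℝ) ≤ ⌊Y⌋₊ := by
        exact_mod_cast hU
      push_cast at this
      linarith
    · exact ⟨le_rfl, by positivity⟩
  have hBV' := hb (2 * x) (by linarith) cfun yfun hcfun' hyfun'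
  have hMBV : ∀ d ∈ Icc 1 D, M d ≤ |∑ n ∈ Icc 1 ⌊yfun d / d⌋₊,
      (ArithmeticFunction.liouville (Int.toNat ((d : ℤ) * n + cfun d)) : ℝ)| := by
    intro d hd
    have hd1 : 1 ≤ d := (Finset.mem_Icc.1 hd).1
    have hd0 : (d : ℝ) ≠ 0 := by exact_mod_cast (show d ≠ 0 by omega)
    simp only [hM, hcfun, hyfun]
    split_ifs with hne
    · obtain ⟨-, hl⟩ := hstar d hne
      simp only [hB]
      rw [hl, mul_div_cancel_left₀ _ hd0, Nat.floor_natCast]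
      refine le_of_eq (congrArg _ (Finset.sum_congr rfl fun n _ => ?_))
      have e : ((d : ℤ) * (n : ℕ) + ((bvCls c (tstar d).1 w ((tstar d).2.1 * (tstar d).2.2) Y : ℕ) : ℤ)).toNat =
          d * n + bvCls c (tstar d).1 w ((tstar d).2.1 * (tstar d).2.2) Y := by
        rw [← Nat.cast_mul, ← Nat.cast_add, Int.toNat_natCast]
      rw [e]
    · positivity
  -- `∑ M ≤ 2 |Cb| x / (log x)^{2A+128}`
  have hlog2x : Real.log x ≤ Real.log (2 * x) := Real.log_le_log hx0 (by linarith)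
  have hS₂ : ∑ d ∈ Icc 1 D, M d ≤ 2 * |Cb| * x / Real.log x ^ (2 * A + 128) := by
    calc ∑ d ∈ Icc 1 D, M d ≤ ∑ d ∈ Icc 1 D, |∑ n ∈ Icc 1 ⌊yfun d / d⌋₊,
          (ArithmeticFunction.liouville (Int.toNat ((d : ℤ) * n + cfun d)) : ℝ)| :=
          Finset.sum_le_sum hMBV
      _ ≤ Cb * (2 * x) / Real.log (2 * x) ^ (2 * A + 128) := hBV'
      _ ≤ |Cb| * (2 * x) / Real.log (2 * x) ^ (2 * A + 128) :=
          div_le_div_of_nonneg_right (mul_le_mul_of_nonneg_right (le_abs_self Cb) (by positivity))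
            (Real.rpow_nonneg (hL0.le.trans hlog2x) _)
      _ ≤ |Cb| * (2 * x) / Real.log x ^ (2 * A + 128) := by
          refine div_le_div_of_nonneg_left (by positivity) (Real.rpow_pos_of_pos hL0 _) ?_
          exact Real.rpow_le_rpow hL0.le hlog2x (by positivity)
      _ = 2 * |Cb| * x / Real.log x ^ (2 * A + 128) := by ring
  -- `∑ τ⁶ M ≤ 2^129 C₆ x (log x)^128`
  have hS₁ : ∑ d ∈ Icc 1 D, (σ 0 d : ℝ) ^ 6 * M d ≤ 2 ^ 129 * C₆ * x * Real.log x ^ (128 : ℕ) := by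
    set Dr : ℝ := max ((2 * x) ^ (1 / 2 - ε / 2)) 2 with hDr
    have hDr2 : 2 ≤ Dr := le_max_right _ _
    have hsub : Icc 1 D ⊆ Icc 1 ⌊Dr⌋₊ := Finset.Icc_subset_Icc le_rfl (Nat.floor_mono (le_max_left _ _))
    have hDrx : Dr ≤ 2 * x := by
      refine max_le ?_ (by linarith)
      calc (2 * x) ^ (1 / 2 - ε / 2) ≤ (2 * x) ^ (1 : ℝ) :=
            Real.rpow_le_rpow_of_exponent_le (by linarith) (by linarith)
        _ = 2 * x := Real.rpow_one _
    have hlogDr : Real.log Dr ≤ 2 * Real.log x := by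
      have h1 : Real.log Dr ≤ Real.log (2 * x) := Real.log_le_log (by linarith) hDrx
      rw [Real.log_mul (by norm_num) hx0.ne'] at h1
      have h2 : Real.log 2 ≤ 1 := by have := Real.log_two_lt_d9; linarith
      linarith
    have hlogDr0 : 0 ≤ Real.log Dr := Real.log_nonneg (by linarith)
    calc ∑ d ∈ Icc 1 D, (σ 0 d : ℝ) ^ 6 * M d ≤ ∑ d ∈ Icc 1 D, (σ 0 d : ℝ) ^ 6 * (2 * x / d) :=
          Finset.sum_le_sum fun d hd => mul_le_mul_of_nonneg_left (hMtriv d hd) (by positivity)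
      _ = 2 * x * ∑ d ∈ Icc 1 D, (σ 0 d : ℝ) ^ 6 / d := by
          rw [Finset.mul_sum]
          refine Finset.sum_congr rfl fun d _ => ?_
          ring
      _ ≤ 2 * x * ∑ d ∈ Icc 1 ⌊Dr⌋₊, (σ 0 d : ℝ) ^ 6 / d := by
          refine mul_le_mul_of_nonneg_left ?_ (by positivity)
          exact Finset.sum_le_sum_of_subset_of_nonneg hsub fun _ _ _ => by positivity
      _ ≤ 2 * x * (C₆ * Real.log Dr ^ 128) := mul_le_mul_of_nonneg_left (h6 Dr hDr2) (by positivity)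
      _ ≤ 2 * x * (C₆ * (2 * Real.log x) ^ 128) := by
          gcongr
      _ = 2 ^ 129 * C₆ * x * Real.log x ^ (128 : ℕ) := by ring
  -- multiplicity and Cauchy–Schwarz
  have hmaps : ∀ t ∈ Box, Nat.lcm (t.2.1 * t.2.2) t.1 ∈ Icc 1 D := by
    intro t ht
    obtain ⟨-, -, -, hl1, hlD⟩ := hBoxmem t ht
    exact Finset.mem_Icc.2 ⟨hl1, hlD⟩
  have hmult : ∑ t ∈ Box, B t ≤ ∑ d ∈ Icc 1 D, (σ 0 d : ℝ) ^ 3 * M d := by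
    rw [← Finset.sum_fiberwise_of_maps_to hmaps]
    refine Finset.sum_le_sum fun d hd => ?_
    have hd0 : d ≠ 0 := by have := (Finset.mem_Icc.1 hd).1; omega
    calc ∑ t ∈ Box.filter (fun t : ℕ × ℕ × ℕ => Nat.lcm (t.2.1 * t.2.2) t.1 = d), B t
        ≤ ∑ _t ∈ Box.filter (fun t : ℕ × ℕ × ℕ => Nat.lcm (t.2.1 * t.2.2) t.1 = d), M d :=
          Finset.sum_le_sum fun t ht => hBM d t ht
      _ = ((Box.filter (fun t : ℕ × ℕ × ℕ => Nat.lcm (t.2.1 * t.2.2) t.1 = d)).card : ℝ) * M d := by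
          rw [Finset.sum_const, nsmul_eq_mul]
      _ ≤ ((σ 0 d : ℕ) : ℝ) ^ 3 * M d := by
          refine mul_le_mul_of_nonneg_right ?_ (hM0 d)
          exact_mod_cast card_lcm_fiber_le Q ⌊R⌋₊ ⌊S'⌋₊ hd0
  have hCS : ∑ d ∈ Icc 1 D, (σ 0 d : ℝ) ^ 3 * M d ≤ K₀ * x / Real.log x ^ A := by
    have hterm : ∀ d ∈ Icc 1 D, (σ 0 d : ℝ) ^ 3 * M d =
        Real.sqrt ((σ 0 d : ℝ) ^ 6 * M d) * Real.sqrt (M d) := by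
      intro d _
      rw [← Real.sqrt_mul (by positivity : (0 : ℝ) ≤ (σ 0 d : ℝ) ^ 6 * M d)]
      rw [show (σ 0 d : ℝ) ^ 6 * M d * M d = ((σ 0 d : ℝ) ^ 3 * M d) ^ 2 by ring]
      rw [Real.sqrt_sq (by positivity)]
    rw [Finset.sum_congr rfl hterm]
    refine (Real.sum_sqrt_mul_sqrt_le (Icc 1 D) (fun d => by positivity) (fun d => hM0 d)).trans ?_
    have hP1 : 0 ≤ 2 ^ 129 * C₆ * x * Real.log x ^ (128 : ℕ) := by positivity
    calc Real.sqrt (∑ d ∈ Icc 1 D, (σ 0 d : ℝ) ^ 6 * M d) * Real.sqrt (∑ d ∈ Icc 1 D, M d)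
        ≤ Real.sqrt (2 ^ 129 * C₆ * x * Real.log x ^ (128 : ℕ)) *
            Real.sqrt (2 * |Cb| * x / Real.log x ^ (2 * A + 128)) := by
          gcongr
      _ = Real.sqrt ((2 ^ 129 * C₆ * x * Real.log x ^ (128 : ℕ)) *
            (2 * |Cb| * x / Real.log x ^ (2 * A + 128))) := (Real.sqrt_mul hP1 _).symm
      _ = Real.sqrt ((K₀ * x / Real.log x ^ A) ^ 2) := by
          congr 1
          have hLsplit : Real.log x ^ (2 * A + 128) = (Real.log x ^ A) ^ 2 * Real.log x ^ (128 : ℕ) := by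
            rw [show (2 : ℝ) * A + 128 = A + A + ((128 : ℕ) : ℝ) by norm_num; ring,
              Real.rpow_add hL0, Real.rpow_add hL0, Real.rpow_natCast]
            ring
          have hK₀sq : K₀ ^ 2 = 2 ^ 130 * C₆ * |Cb| := by
            rw [hK₀, Real.sq_sqrt (by positivity)]
          have hLA0 : Real.log x ^ A ≠ 0 := (Real.rpow_pos_of_pos hL0 A).ne'
          have hL128 : Real.log x ^ (128 : ℕ) ≠ 0 := pow_ne_zero _ hL0.ne'
          rw [hLsplit, div_pow, mul_pow, hK₀sq]
          field_simp
      _ = K₀ * x / Real.log x ^ A := Real.sqrt_sq (by positivity)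
  -- the small terms
  have hsmall : ((c.natAbs : ℝ) + 2) * ((Q : ℝ) * ⌊R⌋₊ * ⌊S'⌋₊) ≤ ((c.natAbs : ℝ) + 2) * x / Real.log x ^ A := by
    have hlogA : Real.log x ^ A ≤ x ^ (1 / 2 : ℝ) := by simpa using hX₁ x hX₁x
    have hLApos : 0 < Real.log x ^ A := Real.rpow_pos_of_pos hL0 A
    rw [mul_div_assoc]
    refine mul_le_mul_of_nonneg_left ?_ (by positivity)
    rw [le_div_iff₀ hLApos]
    calc (Q : ℝ) * ⌊R⌋₊ * ⌊S'⌋₊ * Real.log x ^ A ≤ x ^ (1 / 2 - ε) * x ^ (1 / 2 : ℝ) := by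
          refine mul_le_mul ?_ hlogA hLApos.le (by positivity)
          calc (Q : ℝ) * ⌊R⌋₊ * ⌊S'⌋₊ ≤ (Q : ℝ) * R * S' := by
                refine mul_le_mul (mul_le_mul_of_nonneg_left (Nat.floor_le hR0) (by positivity))
                  (Nat.floor_le hS0) (by positivity) (by positivity)
            _ ≤ x ^ (1 / 2 - ε) := hQRS
      _ ≤ x ^ (1 / 2 : ℝ) * x ^ (1 / 2 : ℝ) := by
          refine mul_le_mul_of_nonneg_right ?_ (by positivity)
          exact Real.rpow_le_rpow_of_exponent_le hx1 (by linarith)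
      _ = x := by rw [← Real.rpow_add hx0]; norm_num
  -- finish
  calc ∑ q ∈ Icc 1 Q, ∑ r ∈ Icc 1 ⌊R⌋₊, ∑ s ∈ Icc 1 ⌊S'⌋₊, |innerSum c q w r s y|
      ≤ ∑ t ∈ Box, B t + ((c.natAbs : ℝ) + 2) * ((Q : ℝ) * ⌊R⌋₊ * ⌊S'⌋₊) := hsumI
    _ ≤ K₀ * x / Real.log x ^ A + ((c.natAbs : ℝ) + 2) * x / Real.log x ^ A :=
        add_le_add (hmult.trans hCS) hsmall
    _ = ((c.natAbs : ℝ) + 2 + K₀) * x / Real.log x ^ A := by ring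

/-- Landing anchor of the split assembly chain (file 3 of 6): a registered, mathematically vacuous sub-goal
(`ledger workitem stub-add … --name assembleChain3_anchor --signature 'True'`) so that this intermediate file passes
the gate's supports check; the registered stub `stub_assembleFrom` is proved in file 6. [this line] -/
theorem assembleChain3_anchor : True := trivial

end Summit.Parity.GeneralizedHardyLittlewood.Cruxes.TypeI2Dilated.PeelToDrappeau

end
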